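import Summits.ResolutionOfSingularities.ResolutionOfSingularities.Theorems.RadicialJungCleanModelsCcurveQuotientDVR
import HarnessLib

/-!
# Route `RadicialJung`, crux `CleanModels` (stmt-15917) — (C-curve) sub-line: a prime with regular one-dimensional quotient is cut out by two regular parameters

Lead `res-B-lead-1` g6 (plan `Cruxes/CleanModels/Lines/Sketch-memo-Ccurve-plan.md` §1 S3, algebraic half of the shared stub `stub_Cc_centreCurve`).  OURS · counted 0.
Nothing here proves resolution in characteristic `p`; resolution in char `p` is NOT proved.

`exists_rsp_of_quotient_regular`: `R` regular local of dimension `3`, `𝔮 ≠ 𝔪` a prime with `R/𝔮` regular of dimension `1` (the local ring of a REGULAR curve through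
the closed point).  Then there is a regular system of parameters `(x, y, z)` with `𝔮 = (x, y)`.  Proof: the cotangent sequence (✓ `spanFinrank_maximalIdeal_add_finrank_eq_of_surjective`)
shows that the image of `𝔮` in `𝔪/𝔪²` is `2`-dimensional; two elements `x, y ∈ 𝔮` with independent images extend to an r.s.p. `(x, y, z)` (✓ `quotient_isRegularLocalRing_tfae`,
Matsumura 14.2); `R/(x, y)` is a discrete valuation ring (✓ `quotient_span_pair_dvr`), so the prime `𝔮/(x, y) ≠ 𝔪/(x, y)` is zero.
-/

noncomputable section

set_option linter.dupNamespace false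

open IsLocalRing Literature.AlgebraicGeometry.Resolution

namespace Summit.ResolutionOfSingularities.ResolutionOfSingularities.Theorems.RadicialJung.CleanModels.Ccurve

/-- The embedding dimension of a regular local ring of dimension `n` is `n`. [folklore] -/
theorem spanFinrank_eq_of_ringKrullDim_eq {R : Type} [CommRing R] [IsRegularLocalRing R] {n : ℕ} (hd : ringKrullDim R = n) :
    (maximalIdeal R).spanFinrank = n := by
  have h := IsRegularLocalRing.spanFinrank_maximalIdeal (R := R)
  rw [hd] at h
  exact_mod_cast h

/-- **A prime with regular one-dimensional quotient in a regular local ring of dimension `3` is generated by two members of a regular system of parameters.**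
[cite: Matsumura1987, Thm. 14.2] -/
theorem exists_rsp_of_quotient_regular {R : Type} [CommRing R] [IsRegularLocalRing R] (hd : ringKrullDim R = 3)
    (𝔮 : Ideal R) [𝔮.IsPrime] (hne : 𝔮 ≠ maximalIdeal R) [IsRegularLocalRing (R ⧸ 𝔮)] (hd1 : ringKrullDim (R ⧸ 𝔮) = 1) :
    ∃ x y z : R, maximalIdeal R = Ideal.span {x, y, z} ∧ 𝔮 = Ideal.span {x, y} := by
  classical
  have hd3 : (maximalIdeal R).spanFinrank = 3 := spanFinrank_eq_of_ringKrullDim_eq hd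
  have he1 : (maximalIdeal (R ⧸ 𝔮)).spanFinrank = 1 := spanFinrank_eq_of_ringKrullDim_eq hd1
  -- the cotangent count: the image of `𝔮` in `𝔪/𝔪²` is `2`-dimensional
  haveI : IsLocalHom (algebraMap R (R ⧸ 𝔮)) := IsLocalHom.of_surjective _ Ideal.Quotient.mk_surjective
  set N : Submodule R ↥(maximalIdeal R) := Submodule.comap (maximalIdeal R).subtype (RingHom.ker (algebraMap R (R ⧸ 𝔮))) with hN
  have hker : RingHom.ker (algebraMap R (R ⧸ 𝔮)) = 𝔮 := by
    rw [Ideal.Quotient.algebraMap_eq, Ideal.mk_ker]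
  have hcount := spanFinrank_maximalIdeal_add_finrank_eq_of_surjective (R := R) (S := R ⧸ 𝔮) Ideal.Quotient.mk_surjective
  rw [he1, hd3, ← hN] at hcount
  set V := Submodule.span (ResidueField R) ((maximalIdeal R).toCotangent '' (N : Set ↥(maximalIdeal R))) with hV
  have hV2 : Module.finrank (ResidueField R) V = 2 := by omega
  -- two elements of `𝔮` with independent images
  obtain ⟨b, hbsub, hbspan, hbli⟩ := exists_linearIndependent (ResidueField R) ((maximalIdeal R).toCotangent '' (N : Set ↥(maximalIdeal R)))
  have hbli' : LinearIndepOn (ResidueField R) id b := hbli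
  haveI : Fintype b := (hbli'.linearIndependent.setFinite).fintype
  have hbcard : b.toFinset.card = 2 := by
    rw [← finrank_span_set_eq_card hbli', hbspan, ← hV, hV2]
  obtain ⟨v₁, v₂, hv12, hbeq⟩ := Finset.card_eq_two.mp hbcard
  have hv₁b : v₁ ∈ b := by rw [← Set.mem_toFinset, hbeq]; simp
  have hv₂b : v₂ ∈ b := by rw [← Set.mem_toFinset, hbeq]; simp
  obtain ⟨n₁, hn₁N, hn₁⟩ := hbsub hv₁b
  obtain ⟨n₂, hn₂N, hn₂⟩ := hbsub hv₂b
  have hn₁q : (n₁ : R) ∈ 𝔮 := by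
    have : n₁ ∈ N := hn₁N
    rw [hN, Submodule.mem_comap] at this; rw [← hker]; exact this
  have hn₂q : (n₂ : R) ∈ 𝔮 := by
    have : n₂ ∈ N := hn₂N
    rw [hN, Submodule.mem_comap] at this; rw [← hker]; exact this
  set x : R := (n₁ : R) with hx
  set y : R := (n₂ : R) with hy
  have hxy : x ≠ y := by
    intro h
    apply hv12
    rw [← hn₁, ← hn₂]
    congr 1
    exact Subtype.ext h
  -- independence of the pair, in the format of `quotient_isRegularLocalRing_tfae`
  have hpair : ∀ c d : ResidueField R, c • v₁ + d • v₂ = 0 → c = 0 ∧ d = 0 := by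
    have hb2 : LinearIndepOn (ResidueField R) id ({v₁, v₂} : Set _) := by
      have : ({v₁, v₂} : Set _) ⊆ b := by
        intro v hv
        rcases hv with rfl | rfl
        exacts [hv₁b, hv₂b]
      exact hbli'.mono this
    exact (LinearIndepOn.pair_iff id hv12).mp hb2
  let S : Finset R := {x, y}
  have hSsub : (S : Set R) ⊆ maximalIdeal R := by
    intro r hr
    simp only [S, Finset.coe_insert, Finset.coe_singleton, Set.mem_insert_iff, Set.mem_singleton_iff] at hr
    rcases hr with rfl | rfl
    exacts [n₁.2, n₂.2]
  have hli : LinearIndependent (ResidueField R) ((⇑(maximalIdeal R).toCotangent).comp (Set.inclusion hSsub)) := by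
    let g : R → (maximalIdeal R).Cotangent := fun r => if h : r ∈ maximalIdeal R then (maximalIdeal R).toCotangent ⟨r, h⟩ else 0
    have hg : LinearIndepOn (ResidueField R) g ({x, y} : Set R) := by
      rw [LinearIndepOn.pair_iff g hxy]
      intro c d hcd
      apply hpair c d
      have hgx : g x = v₁ := by simp only [g, dif_pos n₁.2, hx]; exact hn₁
      have hgy : g y = v₂ := by simp only [g, dif_pos n₂.2, hy]; exact hn₂
      rw [← hgx, ← hgy]; exact hcd
    have hfun : ((⇑(maximalIdeal R).toCotangent).comp (Set.inclusion hSsub)) = fun r : ↥(S : Set R) => g (r : R) := by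
      funext r
      simp only [Function.comp_apply, g]
      rw [dif_pos (show (r : R) ∈ maximalIdeal R from hSsub r.2)]
    rw [hfun]
    have hS' : (S : Set R) = {x, y} := by simp [S]
    rw [hS']
    exact hg
  -- extend to a regular system of parameters
  have htfae := (quotient_isRegularLocalRing_tfae R S hSsub).out 1 0
  obtain ⟨T, hST, hTcard, hTspan⟩ := htfae.mp hli
  have hTcard3 : T.card = 3 := by
    rw [hd] at hTcard; exact_mod_cast hTcard
  -- `T = {x, y, z}`
  have hxT : x ∈ T := hST (by simp [S])
  have hyT : y ∈ T := hST (by simp [S])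
  have hcard1 : ((T.erase x).erase y).card = 1 := by
    rw [Finset.card_erase_of_mem (Finset.mem_erase.mpr ⟨hxy.symm, hyT⟩), Finset.card_erase_of_mem hxT, hTcard3]
  obtain ⟨z, hz⟩ := Finset.card_eq_one.mp hcard1
  have hTeq : T = {x, y, z} := by
    ext r
    constructor
    · intro hr
      by_cases hrx : r = x
      · simp [hrx]
      by_cases hry : r = y
      · simp [hry]
      have : r ∈ (T.erase x).erase y := Finset.mem_erase.mpr ⟨hry, Finset.mem_erase.mpr ⟨hrx, hr⟩⟩
      rw [hz, Finset.mem_singleton] at this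
      simp [this]
    · intro hr
      simp only [Finset.mem_insert, Finset.mem_singleton] at hr
      rcases hr with h | h | h <;> rw [h]
      · exact hxT
      · exact hyT
      · have : z ∈ (T.erase x).erase y := by rw [hz]; exact Finset.mem_singleton_self z
        exact Finset.mem_of_mem_erase (Finset.mem_of_mem_erase this)
  have hmax : maximalIdeal R = Ideal.span {x, y, z} := by
    rw [← hTspan, hTeq]; simp
  refine ⟨x, y, z, hmax, ?_⟩
  -- `𝔮 = (x, y)`: the DVR `R/(x, y)`
  have hrange : Ideal.span (Set.range ![x, y, z]) = maximalIdeal R := by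
    rw [hmax]; congr 1; ext v; simp only [Set.mem_range, Set.mem_insert_iff, Set.mem_singleton_iff]
    constructor
    · rintro ⟨j, rfl⟩; fin_cases j <;> simp
    · rintro (rfl | rfl | rfl); exacts [⟨0, rfl⟩, ⟨1, rfl⟩, ⟨2, rfl⟩]
  obtain ⟨hdom, hdvr, -⟩ := quotient_span_pair_dvr hd3 _ hrange
  set P : Ideal R := Ideal.span {x, y} with hP
  change IsDomain (R ⧸ P) at hdom
  change IsDiscreteValuationRing (R ⧸ P) at hdvr
  haveI := hdom
  haveI := hdvr
  have hPq : P ≤ 𝔮 := by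
    rw [hP, Ideal.span_le]
    intro r hr
    rcases hr with rfl | rfl
    exacts [hn₁q, hn₂q]
  have hkerP : RingHom.ker (Ideal.Quotient.mk P) = P := Ideal.mk_ker
  by_contra hneq
  have hmap_ne : 𝔮.map (Ideal.Quotient.mk P) ≠ ⊥ := by
    intro h0
    rw [Ideal.map_eq_bot_iff_le_ker, hkerP] at h0
    exact hneq (le_antisymm h0 hPq)
  haveI hmap_prime : (𝔮.map (Ideal.Quotient.mk P)).IsPrime :=
    Ideal.map_isPrime_of_surjective Ideal.Quotient.mk_surjective (by rw [hkerP]; exact hPq)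
  have hmap_max : (𝔮.map (Ideal.Quotient.mk P)).IsMaximal := hmap_prime.isMaximal hmap_ne
  apply hne
  have h1 : Ideal.comap (Ideal.Quotient.mk P) (𝔮.map (Ideal.Quotient.mk P)) = 𝔮 := by
    rw [Ideal.comap_map_of_surjective _ Ideal.Quotient.mk_surjective, ← RingHom.ker_eq_comap_bot, hkerP, sup_eq_left.mpr hPq]
  rw [← h1]
  have h2 := Ideal.comap_isMaximal_of_surjective (Ideal.Quotient.mk P) Ideal.Quotient.mk_surjective (K := 𝔮.map (Ideal.Quotient.mk P))
  exact (IsLocalRing.eq_maximalIdeal h2)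

end Summit.ResolutionOfSingularities.ResolutionOfSingularities.Theorems.RadicialJung.CleanModels.Ccurve

end
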